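import Mathlib.Analysis.Distribution.SchwartzSpace.Basic
import Mathlib.Analysis.SpecialFunctions.SmoothTransition
import Mathlib.Analysis.SpecialFunctions.Pow.Deriv
import Mathlib.Analysis.Calculus.BumpFunction.Normed
import Mathlib.Analysis.Calculus.BumpFunction.InnerProduct
import Mathlib.MeasureTheory.Integral.Bochner.ContinuousLinearMap
import HarnessLib

/-!
# Temperate multipliers on the Schwartz space of the line: smooth steps, bumps, half-line powers

Topic `Literature/Analysis/Distribution`. Mathlib's `SchwartzMap.smulLeftCLM` multiplies a Schwartz
function by any function of temperate growth (`Function.HasTemperateGrowth`). This file supplies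
the temperate multipliers used to localise test functions in "energy" (spectral subspaces of
one-parameter unitary groups à la Arveson, `Literature/Analysis/UnboundedOperators`):

* `hasTemperateGrowth_smoothTransition`: Mathlib's smooth step `Real.smoothTransition`
  (`0` on `(-∞, 0]`, `1` on `[1, ∞)`) has temperate growth — its derivative is smooth with compact
  support (`Function.HasTemperateGrowth.of_fderiv`);
* `exists_hasTemperateGrowth_step`: a temperate smooth step `0` on `(-∞, a]`, `1` on `[b, ∞)`;
* `exists_hasTemperateGrowth_bump`: a temperate smooth bump `1` on `[-σ, σ]`, supported in
  `[-2σ, 2σ]` (Mathlib's `ContDiffBump`);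
* `hasTemperateGrowth_rpow_of_one_lt`: `σ ^ p` has temperate growth for temperate `σ > 1` and
  `p ≤ 1` (Mathlib's `Function.HasTemperateGrowth.comp'` with the derivatives
  `Real.iter_deriv_rpow_const` of `y ↦ y ^ p` on `(1, ∞)`; compare
  `Function.hasTemperateGrowth_one_add_norm_sq_rpow`);
* `exists_hasTemperateGrowth_eq_rpow_of_le`: for temperate real `ℓ`, `ε > 0` and `p ≤ 1` there is a
  temperate `m` with `m = ℓ ^ p` on `{ℓ ≥ ε}` (used with `p = ± 1/2`: smooth square roots of
  `2πξ - c` on half-lines);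
* `exists_schwartz_integral_eq_one`, `exists_schwartz_dilate`: a Schwartz kernel of integral one
  and its dilates `a ↦ R k(aR)` (approximate identities).

## References

* L. Hörmander, *The Analysis of Linear Partial Differential Operators I*, §1.4 (cutoff functions,
  partitions of unity) and §7.1 (multipliers of `𝒮`). [HormanderALPDO1]

## Design notes

* Theorems only (existence statements); no new definitions. Real-valued multipliers act on
  `𝓢(ℝ, ℂ)` through the real-scalar `smulLeftCLM`; complex-valued ones via
  `Complex.ofRealCLM`-composition (`Function.HasTemperateGrowth.comp`).
-/

noncomputable section

open Filter MeasureTheory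
open scoped Topology SchwartzMap ContDiff

namespace Literature.Analysis.Distribution

/-! ### Smooth steps and bumps of temperate growth -/

/-- **Mathlib's smooth transition has temperate growth**: `Real.smoothTransition` is bounded by `1`
and its derivative is a smooth function supported in `[0, 1]` (the function is locally constant
off `[0, 1]`), so `Function.HasTemperateGrowth.of_fderiv` applies (Hörmander I, §1.4).
[cite: HormanderALPDO1, §1.4] -/
theorem hasTemperateGrowth_smoothTransition : Real.smoothTransition.HasTemperateGrowth := by
  have hsmooth : ContDiff ℝ ∞ Real.smoothTransition := Real.smoothTransition.contDiff
  have hd := contDiff_infty_iff_fderiv.mp hsmooth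
  -- the derivative vanishes off `[0, 1]`
  have hzero : ∀ x, x ∉ Set.Icc (0 : ℝ) 1 → fderiv ℝ Real.smoothTransition x = 0 := by
    intro x hx
    simp only [Set.mem_Icc, not_and_or, not_le] at hx
    rcases hx with h | h
    · have : Real.smoothTransition =ᶠ[𝓝 x] fun _ => (0 : ℝ) := by
        filter_upwards [Iio_mem_nhds h] with y hy
        exact Real.smoothTransition.zero_of_nonpos (le_of_lt hy)
      rw [this.fderiv_eq, fderiv_const_apply]
    · have : Real.smoothTransition =ᶠ[𝓝 x] fun _ => (1 : ℝ) := by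
        filter_upwards [Ioi_mem_nhds h] with y hy
        exact Real.smoothTransition.one_of_one_le (le_of_lt hy)
      rw [this.fderiv_eq, fderiv_const_apply]
  have hcs : HasCompactSupport (fderiv ℝ Real.smoothTransition) :=
    HasCompactSupport.intro isCompact_Icc hzero
  refine Function.HasTemperateGrowth.of_fderiv (hcs.hasTemperateGrowth hd.2) hd.1 (k := 0)
    (C := 1) fun x => ?_
  rw [pow_zero, mul_one, Real.norm_eq_abs, abs_of_nonneg (Real.smoothTransition.nonneg x)]
  exact Real.smoothTransition.le_one x

/-- **Temperate smooth step**: for `a < b` there is a smooth `θ : ℝ → [0, 1]` of temperate growth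
with `θ = 0` on `(-∞, a]` and `θ = 1` on `[b, ∞)` (`θ(x) = smoothTransition ((x - a)/(b - a))`;
Hörmander I, §1.4). [cite: HormanderALPDO1, §1.4] -/
theorem exists_hasTemperateGrowth_step {a b : ℝ} (hab : a < b) :
    ∃ θ : ℝ → ℝ, θ.HasTemperateGrowth ∧ (∀ x, 0 ≤ θ x) ∧ (∀ x, θ x ≤ 1) ∧
      (∀ x, x ≤ a → θ x = 0) ∧ (∀ x, b ≤ x → θ x = 1) := by
  have hba : 0 < b - a := sub_pos.mpr hab
  have haff : (fun x : ℝ => (b - a)⁻¹ * (x - a)).HasTemperateGrowth := by fun_prop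
  refine ⟨fun x => Real.smoothTransition ((b - a)⁻¹ * (x - a)),
    hasTemperateGrowth_smoothTransition.comp haff, fun x => Real.smoothTransition.nonneg _,
    fun x => Real.smoothTransition.le_one _, fun x hx => ?_, fun x hx => ?_⟩
  · exact Real.smoothTransition.zero_of_nonpos
      (mul_nonpos_of_nonneg_of_nonpos (inv_nonneg.mpr hba.le) (by linarith))
  · refine Real.smoothTransition.one_of_one_le ?_
    rw [le_inv_mul_iff₀ hba]
    linarith

/-- **Temperate smooth bump**: for `σ > 0` there is a smooth `θ : ℝ → [0, 1]` of temperate growth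
with `θ = 1` on `[-σ, σ]` and `tsupport θ ⊆ [-2σ, 2σ]` (Mathlib's `ContDiffBump`; a compactly
supported smooth function has temperate growth). [cite: HormanderALPDO1, §1.4] -/
theorem exists_hasTemperateGrowth_bump {σ : ℝ} (hσ : 0 < σ) :
    ∃ θ : ℝ → ℝ, θ.HasTemperateGrowth ∧ (∀ x, 0 ≤ θ x) ∧ (∀ x, θ x ≤ 1) ∧
      (∀ x, |x| ≤ σ → θ x = 1) ∧ tsupport θ ⊆ Set.Icc (-(2 * σ)) (2 * σ) := by
  let f : ContDiffBump (0 : ℝ) := ⟨σ, 2 * σ, hσ, by linarith⟩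
  refine ⟨f, f.hasCompactSupport.hasTemperateGrowth f.contDiff, fun x => f.nonneg,
    fun x => f.le_one, fun x hx => ?_, ?_⟩
  · exact f.one_of_mem_closedBall (by simpa using hx)
  · rw [f.tsupport_eq]
    intro x hx
    have hx' : |x| ≤ 2 * σ := by simpa using hx
    exact ⟨by linarith [neg_abs_le x], by linarith [le_abs_self x]⟩

/-! ### Powers on a half-line -/

/-- **Real powers of a temperate function bounded below by `1` are temperate**: if `σ` has
temperate growth, `σ > 1` everywhere and `p ≤ 1`, then `σ ^ p` has temperate growth. Proof as for
Mathlib's `Function.hasTemperateGrowth_one_add_norm_sq_rpow`: compose with `y ↦ y ^ p` on the open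
set `(1, ∞)`, whose iterated derivatives `descPochhammer · y ^ (p - n)` are bounded there by
`(1 + |y|)` (`Real.iter_deriv_rpow_const`). [folklore] -/
theorem hasTemperateGrowth_rpow_of_one_lt {σ : ℝ → ℝ} (hσ : σ.HasTemperateGrowth)
    (h1 : ∀ x, 1 < σ x) {p : ℝ} (hp : p ≤ 1) : (fun x => σ x ^ p).HasTemperateGrowth := by
  set t : Set ℝ := Set.Ioi 1 with ht_def
  have ht : Set.range σ ⊆ t := by
    rintro - ⟨x, rfl⟩
    exact h1 x
  have hdiff : ContDiffOn ℝ ∞ (fun y : ℝ => y ^ p) t :=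
    contDiffOn_fun_id.rpow_const_of_ne fun y hy => (lt_trans zero_lt_one hy).ne'
  have hunique : UniqueDiffOn ℝ t := isOpen_Ioi.uniqueDiffOn
  change ((fun y : ℝ => y ^ p) ∘ σ).HasTemperateGrowth
  apply Function.HasTemperateGrowth.comp' ht hunique hdiff _ hσ
  intro N
  refine ⟨1, ∑ k ∈ Finset.range (N + 1), ‖Polynomial.eval p (descPochhammer ℝ k)‖,
    by positivity, ?_⟩
  intro n hn y hy
  have hy1 : 1 < y := hy
  have hy0 : 0 < y := lt_trans zero_lt_one hy1
  have hcd : ContDiffAt ℝ n (fun y : ℝ => y ^ p) y :=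
    Real.contDiffAt_rpow_const (Or.inl hy0.ne')
  rw [norm_iteratedFDerivWithin_eq_norm_iteratedDerivWithin,
    iteratedDerivWithin_eq_iteratedDeriv hunique hcd hy, iteratedDeriv_eq_iterate,
    Real.iter_deriv_rpow_const, norm_mul]
  gcongr 1
  · have hmem : n ∈ Finset.range (N + 1) := Finset.mem_range.mpr (Nat.lt_succ_of_le hn)
    exact Finset.single_le_sum (f := fun k => ‖Polynomial.eval p (descPochhammer ℝ k)‖)
      (fun _ _ => norm_nonneg _) hmem
  · rw [pow_one, Real.norm_eq_abs, abs_of_pos (Real.rpow_pos_of_pos hy0 _), Real.norm_eq_abs,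
      abs_of_pos hy0]
    calc y ^ (p - n) ≤ y ^ (1 : ℝ) :=
          Real.rpow_le_rpow_of_exponent_le hy1.le (by linarith [(n.cast_nonneg : (0 : ℝ) ≤ n)])
      _ = y := Real.rpow_one y
      _ ≤ 1 + y := by linarith

/-- **Temperate extension of a power from a half-line**: for a real function `ℓ` of temperate
growth, `ε > 0` and an exponent `p ≤ 1`, there is a function `m` of temperate growth with
`m(x) = ℓ(x) ^ p` whenever `ε ≤ ℓ(x)`. (Glue `ℓ` to a constant below the threshold with a smooth
step so that the glued function stays `> 1` after rescaling, then take the `p`-th power,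
`hasTemperateGrowth_rpow_of_one_lt`; used with `p = ± 1/2` for smooth square roots of
`2πξ - c` on `{2πξ ≥ c + ε}`.) [folklore] -/
theorem exists_hasTemperateGrowth_eq_rpow_of_le {ℓ : ℝ → ℝ} (hℓ : ℓ.HasTemperateGrowth) {ε : ℝ}
    (hε : 0 < ε) {p : ℝ} (hp : p ≤ 1) :
    ∃ m : ℝ → ℝ, m.HasTemperateGrowth ∧ ∀ x, ε ≤ ℓ x → m x = ℓ x ^ p := by
  -- `S u = u` for `u ≥ 2`, `S > 1` everywhere
  set S : ℝ → ℝ := fun u => 2 + (u - 2) * Real.smoothTransition (u - 1) with hS_def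
  have hS : S.HasTemperateGrowth := by
    have h1 : (fun u : ℝ => Real.smoothTransition (u - 1)).HasTemperateGrowth :=
      hasTemperateGrowth_smoothTransition.comp (by fun_prop)
    have h2 : (fun u : ℝ => u - 2).HasTemperateGrowth := by fun_prop
    exact (Function.HasTemperateGrowth.const 2).add (h2.mul h1)
  have hS2 : ∀ u, 2 ≤ u → S u = u := by
    intro u hu
    simp only [hS_def, Real.smoothTransition.one_of_one_le (show (1 : ℝ) ≤ u - 1 by linarith)]
    ring
  have hS1 : ∀ u, 1 < S u := by
    intro u
    by_cases hu : u ≤ 1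
    · simp only [hS_def, Real.smoothTransition.zero_of_nonpos (show u - 1 ≤ 0 by linarith)]
      norm_num
    · by_cases hu2 : 2 ≤ u
      · rw [hS2 u hu2]
        linarith
      · push Not at hu hu2
        have hst : Real.smoothTransition (u - 1) ≤ 1 := Real.smoothTransition.le_one _
        have : (u - 2) * 1 ≤ (u - 2) * Real.smoothTransition (u - 1) :=
          mul_le_mul_of_nonpos_left hst (by linarith)
        simp only [hS_def]
        linarith
  -- rescale `ℓ` so that the threshold becomes `2`
  set σ : ℝ → ℝ := fun x => S (2 / ε * ℓ x) with hσ_def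
  have hσ : σ.HasTemperateGrowth :=
    hS.comp ((Function.HasTemperateGrowth.const (2 / ε)).mul hℓ)
  have hσ1 : ∀ x, 1 < σ x := fun x => hS1 _
  refine ⟨fun x => (ε / 2) ^ p * σ x ^ p,
    (Function.HasTemperateGrowth.const _).mul (hasTemperateGrowth_rpow_of_one_lt hσ hσ1 hp),
    fun x hx => ?_⟩
  have hℓ0 : 0 ≤ ℓ x := hε.le.trans hx
  have h2 : 2 ≤ 2 / ε * ℓ x := by
    rw [div_mul_eq_mul_div, le_div_iff₀ hε]
    linarith
  simp only [hσ_def, hS2 _ h2]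
  rw [← Real.mul_rpow (by positivity) (by positivity)]
  congr 1
  field_simp

/-! ### Approximate-identity kernels -/

/-- **A Schwartz kernel of integral one** (a normalised smooth bump, viewed as a complex-valued
Schwartz function). [folklore] -/
theorem exists_schwartz_integral_eq_one : ∃ k : 𝓢(ℝ, ℂ), ∫ a, k a = 1 := by
  let f : ContDiffBump (0 : ℝ) := ⟨1, 2, zero_lt_one, one_lt_two⟩
  have hcs : HasCompactSupport fun x : ℝ => (f x : ℂ) :=
    f.hasCompactSupport.comp_left Complex.ofReal_zero
  have hcd : ContDiff ℝ ∞ fun x : ℝ => (f x : ℂ) :=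
    Complex.ofRealCLM.contDiff.comp f.contDiff
  set k₀ : 𝓢(ℝ, ℂ) := hcs.toSchwartzMap hcd with hk₀
  have hint : ∫ a, k₀ a = ((∫ a, f a : ℝ) : ℂ) := by
    simp only [hk₀, HasCompactSupport.toSchwartzMap_toFun]
    exact integral_ofReal
  have hne : (∫ a, k₀ a) ≠ 0 := by
    rw [hint]
    exact Complex.ofReal_ne_zero.mpr f.integral_pos.ne'
  refine ⟨(∫ a, k₀ a)⁻¹ • k₀, ?_⟩
  calc ∫ a, ((∫ a, k₀ a)⁻¹ • k₀) a = ∫ a, (∫ a, k₀ a)⁻¹ • k₀ a := by rfl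
    _ = (∫ a, k₀ a)⁻¹ • ∫ a, k₀ a := integral_smul _ _
    _ = 1 := by rw [smul_eq_mul, inv_mul_cancel₀ hne]

/-- **Dilates of a Schwartz kernel**: for `R ≠ 0`, `a ↦ R k(a R)` is again a Schwartz function
(composition with the linear automorphism `a ↦ a R`). [folklore] -/
theorem exists_schwartz_dilate (k : 𝓢(ℝ, ℂ)) {R : ℝ} (hR : R ≠ 0) :
    ∃ kR : 𝓢(ℝ, ℂ), ∀ a, kR a = R * k (a * R) := by
  refine ⟨(R : ℂ) • SchwartzMap.compCLMOfContinuousLinearEquiv ℂ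
    (ContinuousLinearEquiv.unitsEquivAut ℝ (Units.mk0 R hR)) k, fun a => ?_⟩
  simp [ContinuousLinearEquiv.unitsEquivAut_apply]

end Literature.Analysis.Distribution
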